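import Summits.BirchSwinnertonDyer.BirchSwinnertonDyer.Theorems.SignedLowerHalvesKobayashiLowerHalfLargeImageLambdaTwoStratumCrux
import Summits.BirchSwinnertonDyer.Rank1Residual.Supersingular.KobayashiMainConjectureX7
import Literature.NumberTheory.EllipticCurves.LeadingTermPPartProofs
import Literature.NumberTheory.EllipticCurves.MordellWeilRankZeroProofs
import HarnessLib

/-!
# Route `SignedLowerHalves`, crux 3 `KobayashiLowerHalfLargeImage` (item stmt-BirchSwinnertonDyer-19001):
# the `λ = 2` STRATUM, part 4 — the ANALYTIC-RANK-ZERO reading in the leaf's currency: at an X7 pair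
# with `ord_{s=1} L(E,s) = 0`, `p ≥ 5`, `ρ̄` onto, `p ∣ ∏ c_ℓ` and a certificate `(μ, λ)(L_p^ε) = (0, 2)`,
# Kobayashi's main conjecture for `ε` AND Miller's `BSD(E, p)` follow from PUBLISHED named facts
# (cell `bsd-ssimc`, width seat `bsd-line-slh-p1-w2` gen 6; helper file `--supports 19001`;
# executes §4 (a) of `Cruxes/KobayashiLowerHalfLargeImage/K1G17-SEARCH-LOG.md` down to `BSDp`)

HONEST FRAMING: the crux is OPEN and nothing here proves it for the class; BSD is not proved by any
of this. CONDITIONAL theorems on DISPLAYED binders, all PUBLISHED named facts already in the tree: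
Kobayashi 2003 Thm. 1.2 (`h12`) / Thm. 4.1 (`h41`), the period-unit facts (`h5`, `h3`), Wuthrich 2014
Lemma 20 (`hL20`) and Prop. 21's input `sha_dvd_analyticSha` (`hW`), B. D. Kim 2008 Thm. 3.12 (`hK08`),
B. D. Kim 2013 Cor. 3.15 (`hK13`), Gross–Zagier–Kolyvagin (`hGZK`), modularity (`hmod`, `hmod'`) —
plus PER PAIR: `W.analyticRank = 0`, `p ∣ W.tamagawaProduct` (Cremona/LMFDB datum) and ONE
Mazur–Tate / `(μ, λ)` certificate. CALIBRATION / SUPPORT ONLY (pen rule D34-4 (3)); never an input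
to a registered stub, never a `closes`. Parts 1–3: `…LambdaTwoStratum{,MainConjecture,Crux}.lean`.

## What this file does

* `finite_selmerGroupPInfty_of_analyticRank_eq_zero` — at analytic rank `0`, `Sel_{p^∞}(E/ℚ)` is
  finite (GZK: `E(ℚ)` and `Ш(E/ℚ)` finite; `#Sel_{p^∞} = #Ш[p^∞]`,
  `natCard_selmerGroupPInfty_eq_natCard_primaryComponent_sha`). Plumbing for part 2 §4's `hfin`.
* `kobayashiMainConjecture_of_lam_eq_two_of_dvd_tamagawa_of_analyticRank_eq_zero` — part 2 §4 with
  `hfin` discharged by GZK: `r_an = 0`, `p ∣ ∏ c_ℓ`, certificate `(0, 2)` ⇒ `KobayashiMainConjecture W p ε`.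
* `X7.bsdp_of_lam_eq_two_of_dvd_tamagawa_of_analyticRank_eq_zero` — the same pair gets Miller's
  `BSDp W p` through the tree's X7 rank-zero road
  (`X7.bsdp_of_kobayashiLowerDivisibility_of_surj_of_analyticRank_eq_zero`: Wuthrich Prop. 21 +
  Kim Cor. 3.15 + Pollack, the latter DISCHARGED by `pollack_exists_plusMinusPAdicLFunction_holds`).
* `X7.bsdp_{neg_one,one}_of_mazurTate_lam_two_of_dvd_tamagawa_of_analyticRank_eq_zero` — the
  records-level form: ONE `θ_n` with `μ = 0`, `λ(θ_n) = deg ω_n^± + 2 < pⁿ`.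

What this buys (for the LEAD's census): the analytic-rank-`0` X7 ∧ Surj rows at `p ≥ 5` that are
open in the window are those with `ord_p #Ш_an ≥ 1` (the `ord_p #Ш_an = 0` rows close by the UPPER
half); among them, the rows with `p ∣ ∏ c_ℓ` AND a signed `λ = 2` now close from PUBLISHED facts —
the lower bound on `#Ш[p^∞]` comes from the main conjecture, not from a Kurihara number. Rows with
`p ∤ ∏ c_ℓ` (the one-element converse) and rows with `λ ≥ 3` are NOT touched; `p = 3` is NOT
touched (Kim 2008 is `p > 3`).

References: [Kobayashi2003] Thm. 1.2, Thm. 4.1, (3.6); [KimBD2008MRL] Thm. 3.12; [BDKim2013] Cor. 3.15;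
[Wuthrich2014] Lemma 20, Prop. 21; [Darmon2004] Thm. 3.22 (GZK); [Miller2011LMS] Def. 1.1;
[Pollack2003] Prop. 6.9, 6.10, 6.18; [GreenbergLNM1716] §1 p. 54, §4 p. 103.
-/

set_option autoImplicit false
set_option linter.dupNamespace false

noncomputable section

open scoped Classical MatrixGroups ModularForm

open CongruenceSubgroup PowerSeries WeierstrassCurve Literature.NumberTheory.EllipticCurves
  Literature.NumberTheory.EllipticCurves.ModularForms Literature.Barriers.BirchSwinnertonDyer
  Literature.NumberTheory.EllipticCurves.Rank1Residual Literature.NumberTheory.EllipticCurves.Sprung2017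
  Literature.NumberTheory.EllipticCurves.Kobayashi2003 ZpExtension
  Literature.NumberTheory.EllipticCurves.Rank1Residual.Typed
  Summit.BirchSwinnertonDyer.Rank1Residual Summit.BirchSwinnertonDyer.Rank1Residual.X1.MuLambda
  Summit.BirchSwinnertonDyer.Rank1Residual.Supersingular
  Summit.BirchSwinnertonDyer.BirchSwinnertonDyer.Theorems.LargeImageParityStratum

namespace Summit.BirchSwinnertonDyer.BirchSwinnertonDyer.Theorems.LargeImageLambdaTwoStratum

section RankZero

variable (W : WeierstrassCurve ℚ) [W.IsElliptic] [W.IsGloballyMinimal] (p : ℕ) [Fact p.Prime]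

omit [W.IsGloballyMinimal] in
/-- **At analytic rank `0`, `Sel_{p^∞}(E/ℚ)` is finite** (every prime `p`), granted
Gross–Zagier–Kolyvagin (`hGZK`: `rank E(ℚ) = ord_{s=1} L(E,s)` and `Ш(E/ℚ)` finite when the order is
`≤ 1`): `E(ℚ)` is finite, so `#Sel_{p^∞}(E/ℚ) = #Ш(E/ℚ)[p^∞]`
(`natCard_selmerGroupPInfty_eq_natCard_primaryComponent_sha`), a positive number. Plumbing.
[cite: Darmon2004, Thm. 3.22 (= Thm. 1.14)] [cite: GreenbergLNM1716, §1 p. 54 and §4 p. 103] -/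
theorem finite_selmerGroupPInfty_of_analyticRank_eq_zero
    (hGZK : rank_eq_analyticRank_of_analyticRank_le_one) (h0 : W.analyticRank = 0) :
    Finite (W.selmerGroupPInfty p) := by
  have hr0 : W.mordellWeilRank = 0 := (hGZK W (by omega)).1.trans h0
  haveI : Finite W.toAffine.Point := W.mordellWeilRank_eq_zero_iff_finite.mp hr0
  haveI : Finite W.sha := (hGZK W (by omega)).2
  have hSel : Nat.card (W.selmerGroupPInfty p) =
      Nat.card (AddCommGroup.primaryComponent W.sha p) :=
    W.natCard_selmerGroupPInfty_eq_natCard_primaryComponent_sha p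
  have hpos : 0 < Nat.card (AddCommGroup.primaryComponent W.sha p) := Nat.card_pos
  exact Nat.finite_of_card_ne_zero (by rw [hSel]; exact hpos.ne')

/-- **Kobayashi's main conjecture for `(E, p, ε)` at an ANALYTIC-RANK-ZERO pair with `p ∣ ∏_ℓ c_ℓ`
and certificate `(μ, λ)(L_p^ε) = (0, 2)`** (`p ≥ 5` good, `a_p = 0`, `ρ̄_{E,p}` onto; `f₀` the newform
of level `N_E`): part 2 §4 (`kobayashiMainConjecture_of_lam_eq_two_of_finite_of_dvd_tamagawa`) with
`Sel_{p^∞}(E/ℚ)` finite by GZK. Binders: `h12`, `h41`, `h5`, `h3`, `hL20`, `hK08`, `hK13`, `hGZK`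
— PUBLISHED named facts. PER PAIR: `h0`, `hdvd`, `hcert₀`. No `#Ш`, no Kurihara number.
[cite: Kobayashi2003, Thm. 1.2, Thm. 4.1 and Conjecture (p. 2)] [cite: KimBD2008MRL, Thm. 3.12 (p. 93)]
[cite: BDKim2013, Cor. 3.15 (p. 199)] [cite: Darmon2004, Thm. 3.22] -/
theorem kobayashiMainConjecture_of_lam_eq_two_of_dvd_tamagawa_of_analyticRank_eq_zero
    (h12 : Kobayashi2003.thm12_signedSelmerDual_finite_torsion)
    (h41 : Kobayashi2003.thm41_signedCharIdeal_divisibility)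
    (h5 : realPeriodRat_eq_unit_mul_plusPeriod) (h3 : realPeriodRat_eq_unit_mul_plusPeriod_three)
    (hL20 : Wuthrich2014.lemma20_surjective_threeAdic_of_semistable)
    (hK08 : Kim2008.thm312_signedSelmerDual_charIdeal_map_invol)
    (hK13 : BDKim2013.cor315_signedCharValue_rankZero)
    (hGZK : rank_eq_analyticRank_of_analyticRank_le_one)
    (hp5 : 5 ≤ p) (hgood : W.HasGoodReductionAtPrime p) (hap : W.frobeniusTrace p = 0)
    (hs : Surj W p) (ε : ℤˣ)
    [NeZero (W.conductorNorm ℤ)] {f₀ : CuspForm (Gamma0 (W.conductorNorm ℤ)) 2} (hf₀ : IsNewformOf W f₀)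
    (hcert₀ : ∀ L : IwasawaAlgebra p, IsSignedPAdicLFunction f₀ p ε L → mu L = 0 ∧ lam L = 2)
    (h0 : W.analyticRank = 0) (hdvd : p ∣ W.tamagawaProduct) :
    KobayashiMainConjecture W p ε :=
  kobayashiMainConjecture_of_lam_eq_two_of_finite_of_dvd_tamagawa W p h12 h41 h5 h3 hL20 hK08 hK13 hp5
    hgood hap hs ε hf₀ hcert₀ (finite_selmerGroupPInfty_of_analyticRank_eq_zero W p hGZK h0) hdvd

/-- **X7 ∩ {r_an = 0}, `p ≥ 5`, `ρ̄` onto, `p ∣ ∏ c_ℓ`, certificate `(μ, λ)(L_p^ε) = (0, 2)`: Miller's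
`BSD(E, p)`** — the main conjecture above, read through the tree's X7 rank-zero road
`X7.bsdp_of_kobayashiLowerDivisibility_of_surj_of_analyticRank_eq_zero` (Wuthrich Prop. 21 under
`Surj`, Kim Cor. 3.15, Pollack's theorem DISCHARGED by `pollack_exists_plusMinusPAdicLFunction_holds`,
modularity `hmod`/`hmod'`, GZK). All binders PUBLISHED named facts; PER PAIR `h0`, `hdvd`, `hcert₀`.
On such a row the LOWER bound on `#Ш(E)[p^∞]` is supplied by the main conjecture, so no Kurihara
number / no `#Ш` computation enters. [cite: Wuthrich2014, Prop. 21 (p. 400)] [cite: Miller2011LMS, Def. 1.1]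
[cite: Kobayashi2003, Thm. 1.2, Thm. 4.1, (3.6)] [cite: KimBD2008MRL, Thm. 3.12 (p. 93)] [cite: BDKim2013, Cor. 3.15 (p. 199)] -/
theorem X7.bsdp_of_lam_eq_two_of_dvd_tamagawa_of_analyticRank_eq_zero
    (hW : Wuthrich2014.sha_dvd_analyticSha)
    (h12 : Kobayashi2003.thm12_signedSelmerDual_finite_torsion)
    (h41 : Kobayashi2003.thm41_signedCharIdeal_divisibility)
    (h5 : realPeriodRat_eq_unit_mul_plusPeriod) (h3 : realPeriodRat_eq_unit_mul_plusPeriod_three)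
    (hL20 : Wuthrich2014.lemma20_surjective_threeAdic_of_semistable)
    (hK08 : Kim2008.thm312_signedSelmerDual_charIdeal_map_invol)
    (hK13 : BDKim2013.cor315_signedCharValue_rankZero)
    (hmod : nonempty_modularParametrizationData) (hmod' : hasEntireLFunction_rat)
    (hGZK : rank_eq_analyticRank_of_analyticRank_le_one)
    (hp5 : 5 ≤ p) (hX : ClassX7 W p) (hs : Surj W p) {ε : ℤˣ}
    [NeZero (W.conductorNorm ℤ)] {f₀ : CuspForm (Gamma0 (W.conductorNorm ℤ)) 2} (hf₀ : IsNewformOf W f₀)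
    (hcert₀ : ∀ L : IwasawaAlgebra p, IsSignedPAdicLFunction f₀ p ε L → mu L = 0 ∧ lam L = 2)
    (h0 : W.analyticRank = 0) (hdvd : p ∣ W.tamagawaProduct) : BSDp W p := by
  have hp : p ≠ 2 := by omega
  have hap : W.frobeniusTrace p = 0 := ClassX7.frobeniusTrace_eq_zero_of_five_le W p hp5 hX
  exact X7.bsdp_of_kobayashiLowerDivisibility_of_surj_of_analyticRank_eq_zero W p hW h12 hK13
    (fun {_} _ {_} ↦ pollack_exists_plusMinusPAdicLFunction_holds) hmod hmod' hGZK hp hX hap hs h0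
    (kobayashiLowerDivisibility_of_mainConjecture
      (kobayashiMainConjecture_of_lam_eq_two_of_dvd_tamagawa_of_analyticRank_eq_zero W p h12 h41 h5 h3
        hL20 hK08 hK13 hGZK hp5 hX.1.1 hap hs ε hf₀ hcert₀ h0 hdvd))

/-- **Records-level form, sign `−1` (Kobayashi's `L_p^-` = the tree's `L⁺`, ODD levels)**: an X7 pair with
`r_an = 0`, `p ≥ 5`, `ρ̄` onto, `p ∣ ∏ c_ℓ`, and ONE odd-level Mazur–Tate element `Θ` (`ι Θ = θ_n(f₀)`,
`μ(Θ) = 0`, `λ(Θ) = deg ω_n^+ + 2 < pⁿ`) ⇒ `BSDp W p`. [cite: Pollack2003, Prop. 6.9, 6.10 and 6.18]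
[cite: Wuthrich2014, Prop. 21 (p. 400)] [cite: KimBD2008MRL, Thm. 3.12 (p. 93)] [cite: BDKim2013, Cor. 3.15 (p. 199)] -/
theorem X7.bsdp_neg_one_of_mazurTate_lam_two_of_dvd_tamagawa_of_analyticRank_eq_zero
    (hW : Wuthrich2014.sha_dvd_analyticSha)
    (h12 : Kobayashi2003.thm12_signedSelmerDual_finite_torsion)
    (h41 : Kobayashi2003.thm41_signedCharIdeal_divisibility)
    (h5 : realPeriodRat_eq_unit_mul_plusPeriod) (h3 : realPeriodRat_eq_unit_mul_plusPeriod_three)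
    (hL20 : Wuthrich2014.lemma20_surjective_threeAdic_of_semistable)
    (hK08 : Kim2008.thm312_signedSelmerDual_charIdeal_map_invol)
    (hK13 : BDKim2013.cor315_signedCharValue_rankZero)
    (hmod : nonempty_modularParametrizationData) (hmod' : hasEntireLFunction_rat)
    (hGZK : rank_eq_analyticRank_of_analyticRank_le_one)
    (hp5 : 5 ≤ p) (hX : ClassX7 W p) (hs : Surj W p)
    [NeZero (W.conductorNorm ℤ)] {f₀ : CuspForm (Gamma0 (W.conductorNorm ℤ)) 2} (hf₀ : IsNewformOf W f₀)
    {n : ℕ} (hn : Odd n) {Θ : IwasawaAlgebra p}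
    (hΘ : iwasawaToPowerSeries p Θ =
      ((mazurTateElement f₀ p n).map (algebraMap ℚ ℚ_[p]) : PowerSeries ℚ_[p]))
    (hΘ0 : Θ ≠ 0) (hμ : mu Θ = 0)
    (hlam : lam Θ = (cyclotomicOmegaPlus p n).natDegree + 2) (hlt : lam Θ < p ^ n)
    (h0 : W.analyticRank = 0) (hdvd : p ∣ W.tamagawaProduct) : BSDp W p :=
  have hap : W.frobeniusTrace p = 0 := ClassX7.frobeniusTrace_eq_zero_of_five_le W p hp5 hX
  X7.bsdp_of_lam_eq_two_of_dvd_tamagawa_of_analyticRank_eq_zero W p hW h12 h41 h5 h3 hL20 hK08 hK13 hmod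
    hmod' hGZK hp5 hX hs hf₀
    (fun _ hL ↦ lam_signed_neg_one_eq_of_mazurTate (by omega) hf₀ hX.1.1 hap hL hn hΘ hΘ0 hμ hlam hlt)
    h0 hdvd

/-- **Records-level form, sign `1` (Kobayashi's `L_p^+` = the tree's `L⁻`, EVEN levels)**: `n` even,
`λ(Θ) = deg ω_n^- + 2 < pⁿ`, otherwise as above ⇒ `BSDp W p`. [cite: Pollack2003, Prop. 6.9, 6.10 and 6.18]
[cite: Wuthrich2014, Prop. 21 (p. 400)] [cite: KimBD2008MRL, Thm. 3.12 (p. 93)] [cite: BDKim2013, Cor. 3.15 (p. 199)] -/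
theorem X7.bsdp_one_of_mazurTate_lam_two_of_dvd_tamagawa_of_analyticRank_eq_zero
    (hW : Wuthrich2014.sha_dvd_analyticSha)
    (h12 : Kobayashi2003.thm12_signedSelmerDual_finite_torsion)
    (h41 : Kobayashi2003.thm41_signedCharIdeal_divisibility)
    (h5 : realPeriodRat_eq_unit_mul_plusPeriod) (h3 : realPeriodRat_eq_unit_mul_plusPeriod_three)
    (hL20 : Wuthrich2014.lemma20_surjective_threeAdic_of_semistable)
    (hK08 : Kim2008.thm312_signedSelmerDual_charIdeal_map_invol)
    (hK13 : BDKim2013.cor315_signedCharValue_rankZero)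
    (hmod : nonempty_modularParametrizationData) (hmod' : hasEntireLFunction_rat)
    (hGZK : rank_eq_analyticRank_of_analyticRank_le_one)
    (hp5 : 5 ≤ p) (hX : ClassX7 W p) (hs : Surj W p)
    [NeZero (W.conductorNorm ℤ)] {f₀ : CuspForm (Gamma0 (W.conductorNorm ℤ)) 2} (hf₀ : IsNewformOf W f₀)
    {n : ℕ} (hn : Even n) {Θ : IwasawaAlgebra p}
    (hΘ : iwasawaToPowerSeries p Θ =
      ((mazurTateElement f₀ p n).map (algebraMap ℚ ℚ_[p]) : PowerSeries ℚ_[p]))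
    (hΘ0 : Θ ≠ 0) (hμ : mu Θ = 0)
    (hlam : lam Θ = (cyclotomicOmegaMinus p n).natDegree + 2) (hlt : lam Θ < p ^ n)
    (h0 : W.analyticRank = 0) (hdvd : p ∣ W.tamagawaProduct) : BSDp W p :=
  have hap : W.frobeniusTrace p = 0 := ClassX7.frobeniusTrace_eq_zero_of_five_le W p hp5 hX
  X7.bsdp_of_lam_eq_two_of_dvd_tamagawa_of_analyticRank_eq_zero W p hW h12 h41 h5 h3 hL20 hK08 hK13 hmod
    hmod' hGZK hp5 hX hs hf₀
    (fun _ hL ↦ lam_signed_one_eq_of_mazurTate (by omega) hf₀ hX.1.1 hap hL hn hΘ hΘ0 hμ hlam hlt)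
    h0 hdvd

end RankZero

end Summit.BirchSwinnertonDyer.BirchSwinnertonDyer.Theorems.LargeImageLambdaTwoStratum

end
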